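import Mathlib.Combinatorics.Matroid.Minor.Delete
import Mathlib.Data.Set.Card

/-!
# PercRepro — the deletion split of the 4-circuit count (p1, gen 20; the s₄ recursion's skeleton)

`s₄(M) ≤ #{4-circuits through e} + s₄(M ＼ {e})`: a 4-circuit avoiding `e` is a circuit of `M ＼ {e}`.
Axioms: standard.
-/

open scoped Matroid

namespace PercRepro

namespace S1

open Set

variable {α : Type}

/-- The 4-circuits of `M` are at most those through `e` plus those of `M ＼ {e}`. -/
theorem ncard_fourCircuits_le_through_add_delete (M : Matroid α) [M.Finite] (e : α) :
    {C : Set α | M.IsCircuit C ∧ C.ncard = 4}.ncard ≤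
      {C : Set α | M.IsCircuit C ∧ C.ncard = 4 ∧ e ∈ C}.ncard +
        {C : Set α | (M ＼ {e}).IsCircuit C ∧ C.ncard = 4}.ncard := by
  classical
  set S := {C : Set α | M.IsCircuit C ∧ C.ncard = 4} with hS
  set S₁ := {C : Set α | M.IsCircuit C ∧ C.ncard = 4 ∧ e ∈ C} with hS₁
  set S₂ := {C : Set α | (M ＼ {e}).IsCircuit C ∧ C.ncard = 4} with hS₂
  have hS₁fin : S₁.Finite :=
    M.ground_finite.finite_subsets.subset (fun C hC => hC.1.subset_ground)
  have hS₂fin : S₂.Finite :=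
    (M ＼ {e}).ground_finite.finite_subsets.subset (fun C hC => hC.1.subset_ground)
  have hsplit : S ⊆ S₁ ∪ S₂ := by
    intro C hC
    by_cases h : e ∈ C
    · exact Or.inl ⟨hC.1, hC.2, h⟩
    · exact Or.inr ⟨_root_.Matroid.delete_isCircuit_iff.2 ⟨hC.1, disjoint_singleton_right.2 h⟩, hC.2⟩
  calc S.ncard ≤ (S₁ ∪ S₂).ncard := ncard_le_ncard hsplit (hS₁fin.union hS₂fin)
    _ ≤ S₁.ncard + S₂.ncard := ncard_union_le _ _

end S1

end PercRepro
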